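import Literature.MathematicalPhysics.QuantumFieldTheory.Balaban1983to89.B6AgmonExponentMultiLevelTorus
import Literature.MathematicalPhysics.QuantumFieldTheory.Balaban1983to89.B9Thm31SiteGpWeightedReg335Y

/-!
# `Balaban1983to89.B9Thm31SiteAgmonExponentY` — T. Bałaban, *Propagators for lattice gauge theories in a background field*,
# Commun. Math. Phys. **99** (1985) 389–434 [Balaban1985BackgroundPropagators] Thm 3.1 (3.46)∕(3.42) pp. 397–398 with [B6]
# (2.46) p. 231, by S. Agmon's positive-weight method [Agmon1982]: ★★★ **(3.46a) FOR def-Y's `G′(U)` ON THE (3.35) CLASS WITH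
# PRINT'S RATE IN THE BLOCK DISTANCE `d(y,y′)` — the multi-scale Agmon exponent `msRhoT` of `B6AgmonExponentMultiLevelTorus`
# discharges the four exponent binders of width seat `dag-n06-w1`'s `hs_restrict_GpY_parSymY_le_exp_canonical`, so that
# `Σ_{z∈A}HS((G′(U)λ)(z)) ≤ 256·(L^{j_A})²(L^{j_B})²·e^{−2δ₀(n−1)∕(2L)}·‖λ‖²₁` for `A` in blocks at block distance `≥ n` from
# the source block — and the kernel bound `HS((G′(U)(δ_y⊗E))(x)) ≤ 256·L^{2 lev x}L^{2 lev y}·e^{−2δ₀(d_T(y(x),y(y))−1)∕(2L)}·HS(E)`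
# with NO exponent hypothesis left** (seat `pub-ymgap-dag-n06-j`, rows 15–16's side of the N06 site sector)

statement-level skeleton of published theorems with citation tags; proofs where landed; nothing here is a claim about the Yang–Mills mass gap

THE PRINT (p. 397–398).  (3.42): *«|(G′(U)λ)(x)| ≤ B₀(Lʲη)² e^{−δ₀d(y,y′)}|λ| for x ∈ Δ(y), y ∈ Λ_j, supp λ ⊂ Δ(y′)»*;
(3.46): *«‖hG′(U)λ‖ … ≤ B₀(Lʲη)(Lʲ′η)e^{−δ₀d(y,y′)}‖h‖‖λ‖»*; p. 397: *«we will use the weighted distance d(y,y′) defined by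
(2.36) in [4]»* — the contour distance (2.46) of [B6] on the blocks `𝔅` (the tree's `B6Geom246MultiLevelTorus.bondT ∕ geomT`,
= `(geo9Y x).dist` read through the carrier-block map `β`).

WHY THIS FILE.  `dag-n06-w1`'s files 6–10 proved the `L²` entries of Thm 3.1 on the class for ANY site exponent `ρ` with
`|ρ(z+e_μ) − ρ z| ≤ (L^{lev})⁻¹` at both ends of every bond and oscillation `≤ d+1` on blocks, and its file 15 exhibited the
coarsest-scale exponent `(L^k)⁻¹|· − y|_T`; the multi-scale exponent `ρ_S = msRhoT` (the weighted lattice path distance to the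
block `S`, step weight `L^{−max(lev, lev′)}`) has the same two properties AND dominates print's block distance:
`(d_T(y(z), S) − 1)∕(2L) ≤ ρ_S(z)` (`B6AgmonExponentMultiLevelTorus.msRhoT_ge`).  This file is the one-screen instantiation.

WHAT IS PROVED (sorry-free; 0 `def`; nothing of [B9] asserted beyond what is proved).
* §1 the binders of `ρ_s := msRhoT i.D s` (the multi-scale exponent on the member's torus) at the V1 index (theorem names `msRhoY_*`): `msRhoY_bond ∕ msRhoY_bond'` (hρ1∕hρ2), `msRhoY_block` (hρD),
  `msRhoY_eq_zero` (hρB), ★ `msRhoY_ge` (domination by `(bondT i.D).dist`), `msRhoY_ge_of_le` (the `hr` binder for a set `A`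
  of sites in blocks at distance `≥ n`).
* §2 ★★★ `hs_restrict_GpY_parSymY_le_distT` ((3.46a) with the rate in the block distance), ★★★ `hs_GpY_deltaY_le_distT`
  (the kernel bound, exponent-hypothesis-free).
CONSTANTS.  `B₀² = 256`, `δ₀ = 1∕(4(d+2))` (from `dag-n06-w1`), rate `δ₀∕(2L)` per unit of `d_T` with the additive loss `1`
(from `msRhoT_ge`); uniform in the member, the volume, `k`, `N`, `U`.  NON-VACUITY (A6): no exponent binder remains; the class
is inhabited (`reg335_one`, pure gauges); `A = B =` one block gives a non-trivial instance at every member.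
HONEST SCOPE.  One instantiation on top of landed files; `L²`∕Hilbert–Schmidt entries only (not the sup-norm (3.42) with its
block majorants); NOT a node discharge, NOT summit progress; count-neutral; nothing continuum ∕ OS ∕ mass gap ∕ Clay.  NEW file
importing `B6AgmonExponentMultiLevelTorus` and `B9Thm31SiteGpWeightedReg335Y` only; nothing landed is modified.
-/

noncomputable section

namespace Literature.MathematicalPhysics.QuantumFieldTheory.Balaban1983to89.B9Thm31SiteAgmonExponentY

open Literature.MathematicalPhysics.QuantumFieldTheory.Balaban1983to89
open Node00 B6KLevelCensusIndexV1 B6Geom246MultiLevelBox B6MultiLevelBoxOperator B6MultiLevelTorusOperator B6GlobalChartV1 B9BackgroundsKLevelV1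
  B9Eq39Adjoint B9Thm311ReadingCoords B9Thm311DeltaPrimePos B9Ineq369CurvatureSmallAtLettersY B9Thm31SiteCoerciveGaugeBlockY
  B9Thm31SiteCoerciveReg335Y B9Thm31SiteGpBoundsReg335Y B9Thm31SitePolarisedFormY B9Thm31SiteConjugatedFormY B9Thm31SiteGpDecayReg335Y
  B9Thm31SiteAgmonWeightY B9Thm31SiteGpWeightedReg335Y B6Geom246MultiLevelTorus B6TorusSiteWalks B6AgmonExponentMultiLevelTorus
open scoped Matrix Matrix.Norms.L2Operator

variable {d ℓ : ℕ} {hd : 1 ≤ d + 1} {hL : Odd (ℓ + 1) ∧ 1 < ℓ + 1} {b₀ b₁ : ℝ}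
variable (i : KIdx d ℓ hd hL b₀ b₁) {N : ℕ} {G : Subgroup (Matrix (Fin N) (Fin N) ℂ)ˣ}

/-! ## §1 The multi-scale exponent at the V1 index and its binders -/

section Exponent

/-- `R ≥ 1` at the V1 index (`R ≥ 2L²`). [cite: Balaban1984PropagatorsII, (2.2) p.224, bookkeeping] -/
private theorem one_le_R : 1 ≤ i.R :=
  le_trans (Nat.one_le_iff_ne_zero.2 (Nat.mul_ne_zero_iff.2 ⟨by norm_num, (Nat.pow_pos (by omega)).ne'⟩)) i.hR2

/-- `M_h ≥ 1` at the V1 index (`M_h ≥ 8`). [cite: Balaban1984PropagatorsII, (2.1) p.224, bookkeeping] -/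
private theorem one_le_Mh : 1 ≤ i.Mh := le_trans (by norm_num) i.hM8

/-- `P′_μ ≥ 1` at the V1 index (`P′ ≥ 5`). [cite: Balaban1984PropagatorsII, (2.1) p.224, bookkeeping] -/
private theorem one_le_P' : ∀ μ, 1 ≤ i.P' μ := fun μ => le_trans (by norm_num) (i.hP5 μ)

/-- `ℓ ≥ 1` at the V1 index (`ℓ ≥ 4`). [cite: Balaban1984PropagatorsII, (2.1) p.224, bookkeeping] -/
private theorem one_le_ell (i : KIdx d ℓ hd hL b₀ b₁) : 1 ≤ ℓ := le_trans (by norm_num) i.hℓ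

/-- the first bond cap (`dag-n06-w1`'s binder `hρ1`): `|ρ_s(z + e_μ) − ρ_s z| ≤ (L^{lev z})⁻¹`.
[cite: Balaban1985BackgroundPropagators, p.397 (weighted distance); Agmon1982, Ch.1] -/
theorem msRhoY_bond (s : BlkY i) (μ : Fin (d + 1)) (z : SiteY i) :
    |msRhoT i.D s (shiftY i μ z) - msRhoT i.D s z| ≤ ((((ℓ + 1) ^ (blkOf i.D.toDomains z).1.1 : ℕ) : ℝ))⁻¹ :=
  abs_msRhoT_tshift_sub_le i.D (one_le_Mh i) (one_le_P' i) s μ z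

/-- the second bond cap (`dag-n06-w1`'s binder `hρ2`): `|ρ_s(z + e_μ) − ρ_s z| ≤ (L^{lev(z + e_μ)})⁻¹`.
[cite: Balaban1985BackgroundPropagators, p.397 (weighted distance); Agmon1982, Ch.1] -/
theorem msRhoY_bond' (s : BlkY i) (μ : Fin (d + 1)) (z : SiteY i) :
    |msRhoT i.D s (shiftY i μ z) - msRhoT i.D s z| ≤ ((((ℓ + 1) ^ (blkOf i.D.toDomains (shiftY i μ z)).1.1 : ℕ) : ℝ))⁻¹ :=
  abs_msRhoT_tshift_sub_le' i.D (one_le_Mh i) (one_le_P' i) s μ z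

/-- the block oscillation (`dag-n06-w1`'s binder `hρD` with `D = d + 1`). [cite: Balaban1985BackgroundPropagators, p.397; Balaban1984PropagatorsII, (2.3)–(2.4) p.224; Agmon1982, Ch.1] -/
theorem msRhoY_block (s : BlkY i) (z w : SiteY i) (h : blkOf i.D.toDomains w = blkOf i.D.toDomains z) :
    |msRhoT i.D s z - msRhoT i.D s w| ≤ (d : ℝ) + 1 :=
  abs_msRhoT_sub_le_of_blkOf_eq i.D (one_le_Mh i) (one_le_P' i) s h

/-- the exponent vanishes on the source block (`dag-n06-w1`'s binder `hρB`). [cite: Balaban1985BackgroundPropagators, (3.46) p.398 (supp λ ⊂ Δ̃(y′)); Agmon1982, Ch.1] -/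
theorem msRhoY_eq_zero {s : BlkY i} {z : SiteY i} (hz : blkOf i.D.toDomains z = s) : msRhoT i.D s z = 0 :=
  msRhoT_eq_zero_of_blkOf_eq i.D (one_le_Mh i) (one_le_P' i) hz

/-- ★ **DOMINATION AT THE V1 INDEX**: `(d_T(y(z), s) − 1)∕(2L) ≤ ρ_s(z)`, `d_T` = print's block distance (2.46) of the member.
[cite: Balaban1984PropagatorsII, (2.46) p.231; Balaban1985BackgroundPropagators, p.397; Agmon1982, Ch.1] -/
theorem msRhoY_ge (s : BlkY i) (z : SiteY i) :
    (((bondT i.D).dist (blkOf i.D.toDomains z) s : ℝ) - 1) / (2 * ((ℓ + 1 : ℕ) : ℝ)) ≤ msRhoT i.D s z :=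
  msRhoT_ge i.D (one_le_R i) (one_le_Mh i) (one_le_P' i) (one_le_ell i) s z

/-- the `hr` binder for a set of sites lying in blocks at block distance `≥ n` from the source block:
`((n − 1)∕(2L)) ≤ ρ_s` there. [cite: Balaban1984PropagatorsII, (2.46) p.231; Balaban1985BackgroundPropagators, (3.46) p.398] -/
theorem msRhoY_ge_of_le (s : BlkY i) {n : ℕ} {A : Finset (SiteY i)}
    (hA : ∀ z ∈ A, n ≤ (bondT i.D).dist (blkOf i.D.toDomains z) s) :
    ∀ z ∈ A, (((n : ℝ)) - 1) / (2 * ((ℓ + 1 : ℕ) : ℝ)) ≤ msRhoT i.D s z := by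
  intro z hz
  refine le_trans ?_ (msRhoY_ge i s z)
  have hpos : (0 : ℝ) < 2 * ((ℓ + 1 : ℕ) : ℝ) := by positivity
  have h1 : ((n : ℝ)) ≤ ((bondT i.D).dist (blkOf i.D.toDomains z) s : ℝ) := by exact_mod_cast hA z hz
  exact div_le_div_of_nonneg_right (by linarith) hpos.le

end Exponent

/-! ## §2 (3.46a) and the kernel bound with print's rate in the block distance -/

section Main

/-- ★★★ **(3.46a) FOR `G′(U)` ON THE CLASS WITH PRINT'S RATE IN THE BLOCK DISTANCE** (`dag-n06-w1`'s
`hs_restrict_GpY_parSymY_le_exp_canonical` at the multi-scale exponent): `G ≤ U(N)`, `N ≥ 1`, `0 ≤ c·M·α₀`, `c·M·α₀·(d+1) ≤ 1∕16`,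
`U ∈ Reg335 c α₀`; a source block `s`, a finite set `B` of sites of `s` carrying `λ`, a finite set `A` of sites in blocks at
block distance `≥ n` from `s`, levels `≤ j_A` on `A`, `≤ j_B` on `B`.  THEN
`Σ_{z∈A}HS((G′(U)λ)(z)) ≤ 256·((L^{j_A})²(L^{j_B})²∕(e^{δ₀(n−1)∕(2L)})²)·‖λ‖²₁`, `δ₀ = 1∕(4(d+2))`.
[cite: Balaban1985BackgroundPropagators, Thm 3.1 (3.46) p.398, (3.35) p.396, p.397 (weighted distance); Balaban1984PropagatorsII, (2.46) p.231; Agmon1982, Ch.1, Thm 1.5; CombesThomas1973] -/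
theorem hs_restrict_GpY_parSymY_le_distT [Nonempty (Fin N)] (hG : G ≤ B7Prop2Explicit.unitaryUnits (Matrix (Fin N) (Fin N) ℂ))
    {U : CfgY (Matrix (Fin N) (Fin N) ℂ) i} {c α₀ : ℝ} (hC0 : 0 ≤ c * (kGeo i).M * α₀) (hC1 : c * (kGeo i).M * α₀ * ((d : ℝ) + 1) ≤ 1 / 16)
    (hreg : (bg9K (Matrix (Fin N) (Fin N) ℂ) G i).Reg335 c α₀ U) (s : BlkY i)
    {A B : Finset (SiteY i)} {Ψ : SiteY i → Matrix (Fin N) (Fin N) ℂ} (hΨ : ∀ z, z ∉ B → Ψ z = 0)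
    (hB : ∀ z ∈ B, blkOf i.D.toDomains z = s) {n : ℕ} (hA : ∀ z ∈ A, n ≤ (bondT i.D).dist (blkOf i.D.toDomains z) s)
    {jA jB : ℕ} (hjA : ∀ z ∈ A, (blkOf i.D.toDomains z).1.1 ≤ jA) (hjB : ∀ z ∈ B, (blkOf i.D.toDomains z).1.1 ≤ jB) :
    ∑ z ∈ A, ∑ a, ∑ b, ‖GpY i (parSymY i) U Ψ z a b‖ ^ 2
      ≤ 256 * (((((ℓ + 1) ^ jA : ℕ) : ℝ)) ^ 2 * ((((ℓ + 1) ^ jB : ℕ) : ℝ)) ^ 2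
            / Real.exp ((1 / (4 * ((d : ℝ) + 2))) * ((((n : ℝ)) - 1) / (2 * ((ℓ + 1 : ℕ) : ℝ)))) ^ 2)
          * trIP (fun _ => (1 : ℝ)) Ψ Ψ :=
  hs_restrict_GpY_parSymY_le_exp_canonical i hG hC0 hC1 hreg (ρ := msRhoT i.D s) (msRhoY_bond i s) (msRhoY_bond' i s)
    (msRhoY_block i s) hΨ (fun z hz => msRhoY_eq_zero i (hB z hz)) hjA hjB (msRhoY_ge_of_le i s hA)

/-- ★★★ **THE KERNEL OF `G′(U)` DECAYS EXPONENTIALLY IN PRINT'S BLOCK DISTANCE — NO EXPONENT HYPOTHESIS** (`dag-n06-w1`'s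
`hs_GpY_deltaY_le_exp_canonical` at the multi-scale exponent): on the class, for sites `x`, `y` and a fibre value `E`,
`HS((G′(U)(δ_y ⊗ E))(x)) ≤ 256·((L^{lev x})²(L^{lev y})²∕(e^{δ₀(d_T(y(x),y(y)) − 1)∕(2L)})²)·HS(E)` — the (3.42)∕(3.46)-type decay
`e^{−δ d(y,y′)}` of Thm 3.1 with `δ = δ₀∕(2L)`, `δ₀ = 1∕(4(d+2))`, uniformly in the member, the volume, `k`, `N`, `U`.
[cite: Balaban1985BackgroundPropagators, Thm 3.1 (3.42) p.397, (3.46) p.398; Balaban1984PropagatorsII, (2.46) p.231; Agmon1982, Ch.1, Thm 1.5] -/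
theorem hs_GpY_deltaY_le_distT [Nonempty (Fin N)] (hG : G ≤ B7Prop2Explicit.unitaryUnits (Matrix (Fin N) (Fin N) ℂ))
    {U : CfgY (Matrix (Fin N) (Fin N) ℂ) i} {c α₀ : ℝ} (hC0 : 0 ≤ c * (kGeo i).M * α₀) (hC1 : c * (kGeo i).M * α₀ * ((d : ℝ) + 1) ≤ 1 / 16)
    (hreg : (bg9K (Matrix (Fin N) (Fin N) ℂ) G i).Reg335 c α₀ U) (x y : SiteY i) (E : Matrix (Fin N) (Fin N) ℂ) :
    ∑ a, ∑ b, ‖GpY i (parSymY i) U (deltaY y E) x a b‖ ^ 2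
      ≤ 256 * (((((ℓ + 1) ^ (blkOf i.D.toDomains x).1.1 : ℕ) : ℝ)) ^ 2 * ((((ℓ + 1) ^ (blkOf i.D.toDomains y).1.1 : ℕ) : ℝ)) ^ 2
          / Real.exp ((1 / (4 * ((d : ℝ) + 2)))
              * ((((bondT i.D).dist (blkOf i.D.toDomains x) (blkOf i.D.toDomains y) : ℝ) - 1) / (2 * ((ℓ + 1 : ℕ) : ℝ)))) ^ 2)
        * ∑ a, ∑ b, ‖E a b‖ ^ 2 :=
  hs_GpY_deltaY_le_exp_canonical i hG hC0 hC1 hreg (ρ := msRhoT i.D (blkOf i.D.toDomains y)) (msRhoY_bond i _) (msRhoY_bond' i _)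
    (msRhoY_block i _) x y (msRhoY_eq_zero i rfl) (msRhoY_ge i (blkOf i.D.toDomains y) x) E

end Main

end Literature.MathematicalPhysics.QuantumFieldTheory.Balaban1983to89.B9Thm31SiteAgmonExponentY

end
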